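import Summits.CriticalPhenomena.PercolationContinuityZ3.Theorems.PercNearOneGluingNoHeavyLowerTailMixCSHPeel
import Summits.CriticalPhenomena.PercolationContinuityZ3.Theorems.PercNearOneGluingNoHeavyLowerTailKNQuestion9Pair
import Summits.CriticalPhenomena.PercolationContinuityZ3.Theorems.PercNearOneGluingNoHeavyLowerTailKNQuestion7AllRelays
import HarnessLib

/-!
# Kozma–Nitzan's Question 9 for EVERY relay set, from the mixed conditioned slack hierarchy (Theorem M1 ⟹ Question 9)

Support file (`--supports stmt-CriticalPhenomena-4575`), prover `prim-ineq-gen-7` (gen 8).  No definitions, no named facts, no sorries.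
Memo `prim-ineq-gen-7/PROOF-Q9-MIXED-CSH.md` §4 ("PROOF OF Q9"), roadmap §9.4.

The socket for the end of the roadmap: `MixCSH.kn_question9_of_mixCSH` — on `Fin n`, for an observer `o`, the relay graph `H = restrW {o}ᶜ w`
(pairs at `o` closed; weights `< 1` on the other pairs), IF the mixed hierarchy `MixCSH.MixCSHHolds H Σ x Y D o v` holds for every hub set
`Σ ∌ o`, every owner / avoided set / decoy list and the spare observer `v` (Theorem M1 of the memo — the one remaining piece of the roadmap), THEN
for every relay set `A ∌ o, v`, every target `b` and the Question-9 designation `c ∈ A` (`P_H(c↔b) ≤ P_H(a↔b)`, `a ∈ A`):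
`P_G(c↔b, o↔A) ≤ P_G(o↔b, o↔A)` — Kozma–Nitzan's (41), arXiv:2401.12397 §5.5 Question 9, for every `|A|`.
Chain: Theorem M2 at `D = []` (`MixCSH.mixPreMargin_nonneg_of_mixCSH`) gives `Δ^G_o(A) ≥ p·Δ^H_v(A)` in hub form for every `Σ`; `Δ^H_v(A) ≥ 0` is the
tree's Question 7 in `H` (`Q7Psi.kn_question7`, `c` IS the `H`-minimiser); the hub form of `Δ^G_o(A) ≥ 0` for `F = 1{b ∈ ·}` is the set-source
inequality, and `KnQ9Pair.question9_of_setSource` (law of total probability over the pinned star of `o`) returns to `G`.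
With `…KnQuestion9Shortening.lean` (`shorteningStep_of_question9`) this is the route to KN Conjecture 6 without hypothesis (39).
[cite: KozmaNitzan2024, Question 9 (§5.5 p. 36), Conjecture 6 (§5.3 p. 34), Question 7 (p. 36)] [cite: VandenbergHaggstromKahn2005, Thm. 2.1 (p. 9)]
-/

noncomputable section

namespace Summit.CriticalPhenomena.PercolationContinuityZ3.Theorems

open MeasureTheory Set Literature.Probability.LatticeModels Literature.Probability.Percolation
open scoped Classical

namespace MixCSH

variable {n : ℕ}

/-- **The hub form of `Δ^G_o(A) ≥ 0` for `F = 1{b ∈ ·}` is the set-source inequality.**  For the indicator functional,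
`mixPreF w Σ o A c F o = μ({Σ↔b} ∩ {Σ↔A}) − μ({c ↔^Σ b} ∩ {Σ↔A})`. [cite: KozmaNitzan2024, Question 9 (§5.5 p. 36)] -/
theorem mixPreF_hub_indicator (w : Sym2 (Fin n) → unitInterval) (Sig : Set (Fin n)) (o : Fin n) (A : Finset (Fin n)) (c b : Fin n) :
    mixPreF w Sig o A c (fun S => if b ∈ S then (1 : ℝ) else 0) o =
      (prodBernoulli w).real
          {η : BondConfig (Fin n) | (∃ s ∈ Sig, (openGraph η).Reachable s b) ∧ ∃ a ∈ A, ∃ s ∈ Sig, (openGraph η).Reachable s a} -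
        (prodBernoulli w).real
          {η : BondConfig (Fin n) | ((openGraph η).Reachable c b ∨
              ((∃ s ∈ Sig, (openGraph η).Reachable s c) ∧ ∃ s ∈ Sig, (openGraph η).Reachable s b)) ∧
            ∃ a ∈ A, ∃ s ∈ Sig, (openGraph η).Reachable s a} := by
  classical
  set μ := prodBernoulli w with hμ
  have hmeas : ∀ S : Set (BondConfig (Fin n)), MeasurableSet S := fun _ => MeasurableSet.of_discrete
  rw [mixPreF_hub]
  set E : Set (BondConfig (Fin n)) := {ω | ∃ σ ∈ Sig, ∃ a ∈ A, (openGraph ω).Reachable a σ} with hE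
  set B1 : Set (BondConfig (Fin n)) := {η | ∃ s ∈ Sig, (openGraph η).Reachable s b} with hB1
  set B2 : Set (BondConfig (Fin n)) := {η | (openGraph η).Reachable c b ∨
      ((∃ s ∈ Sig, (openGraph η).Reachable s c) ∧ ∃ s ∈ Sig, (openGraph η).Reachable s b)} with hB2
  have hE' : ∀ η : BondConfig (Fin n), η ∈ E ↔ ∃ a ∈ A, ∃ s ∈ Sig, (openGraph η).Reachable s a := by
    intro η
    simp only [hE, mem_setOf_eq]
    constructor
    · rintro ⟨σ, hσ, a, ha, h⟩; exact ⟨a, ha, σ, hσ, h.symm⟩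
    · rintro ⟨a, ha, σ, hσ, h⟩; exact ⟨σ, hσ, a, ha, h.symm⟩
  have hiff1 : ∀ η : BondConfig (Fin n), b ∈ hubCluster Sig η ↔ η ∈ B1 := by
    intro η
    simp only [hubCluster, mem_iUnion, hB1, mem_setOf_eq, exists_prop]
    rfl
  -- the second indicator, for EVERY `Decidable` instance of the inner `if` (the definition's instance is the classical one)
  have hiff2 : ∀ (η : BondConfig (Fin n)) (inst : Decidable (∃ σ ∈ Sig, (openGraph η).Reachable c σ)),
      (b ∈ @ite _ (∃ σ ∈ Sig, (openGraph η).Reachable c σ) inst (openCluster η c ∪ hubCluster Sig η) (openCluster η c)) ↔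
        η ∈ B2 := by
    intro η inst
    simp only [hB2, mem_setOf_eq]
    by_cases hc : ∃ σ ∈ Sig, (openGraph η).Reachable c σ
    · rw [if_pos hc]
      simp only [mem_union, hubCluster, mem_iUnion, exists_prop]
      have hc' : ∃ s ∈ Sig, (openGraph η).Reachable s c := by
        obtain ⟨σ, hσ, h⟩ := hc; exact ⟨σ, hσ, h.symm⟩
      constructor
      · rintro (h | ⟨σ, hσ, h⟩)
        · exact Or.inl h
        · exact Or.inr ⟨hc', σ, hσ, h⟩
      · rintro (h | ⟨_, σ, hσ, h⟩)
        · exact Or.inl h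
        · exact Or.inr ⟨σ, hσ, h⟩
    · rw [if_neg hc]
      have hc' : ¬ ∃ s ∈ Sig, (openGraph η).Reachable s c := fun ⟨σ, hσ, h⟩ => hc ⟨σ, hσ, h.symm⟩
      constructor
      · intro h; exact Or.inl h
      · rintro (h | ⟨h, _⟩)
        · exact h
        · exact absurd h hc'
  have h1 : ∀ η : BondConfig (Fin n), (if b ∈ hubCluster Sig η then (1 : ℝ) else 0) = B1.indicator 1 η := by
    intro η
    by_cases h : η ∈ B1
    · rw [if_pos ((hiff1 η).2 h), indicator_of_mem h, Pi.one_apply]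
    · rw [if_neg (fun h' => h ((hiff1 η).1 h')), indicator_of_notMem h]
  have h2 : ∀ (η : BondConfig (Fin n)) (inst : Decidable (∃ σ ∈ Sig, (openGraph η).Reachable c σ)),
      (if b ∈ @ite _ (∃ σ ∈ Sig, (openGraph η).Reachable c σ) inst (openCluster η c ∪ hubCluster Sig η) (openCluster η c)
        then (1 : ℝ) else 0) = B2.indicator 1 η := by
    intro η inst
    by_cases h : η ∈ B2
    · rw [if_pos ((hiff2 η inst).2 h), indicator_of_mem h, Pi.one_apply]
    · rw [if_neg (fun h' => h ((hiff2 η inst).1 h')), indicator_of_notMem h]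
  refine (setIntegral_congr_fun (hmeas E) (g := fun ω => B1.indicator (1 : BondConfig (Fin n) → ℝ) ω - B2.indicator 1 ω)
    (fun ω _ => ?_)).trans ?_
  · simp only [h1, h2]
  rw [integral_sub (Integrable.of_finite).integrableOn (Integrable.of_finite).integrableOn,
    KNPreFKG.setIntegral_indicator_one_eq, KNPreFKG.setIntegral_indicator_one_eq]
  have e1 : E ∩ B1 = {η : BondConfig (Fin n) | (∃ s ∈ Sig, (openGraph η).Reachable s b) ∧ ∃ a ∈ A, ∃ s ∈ Sig, (openGraph η).Reachable s a} := by
    ext η; simp only [mem_inter_iff, hE' η, hB1, mem_setOf_eq]; tauto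
  have e2 : E ∩ B2 = {η : BondConfig (Fin n) | ((openGraph η).Reachable c b ∨
      ((∃ s ∈ Sig, (openGraph η).Reachable s c) ∧ ∃ s ∈ Sig, (openGraph η).Reachable s b)) ∧
      ∃ a ∈ A, ∃ s ∈ Sig, (openGraph η).Reachable s a} := by
    ext η; simp only [mem_inter_iff, hE' η, hB2, mem_setOf_eq]; tauto
  rw [e1, e2]

/-- **KOZMA–NITZAN'S QUESTION 9 FOR EVERY RELAY SET, from the mixed hierarchy (Theorem M1 ⟹ Q9).**  On `Fin n`: observer `o`, relay graph
`H = restrW {o}ᶜ w` with weights `< 1` off `o`, a spare vertex `v ∉ A`, `v ≠ o`.  IF `MixCSHHolds H Σ x Y D o v` for every `Σ ∌ o` and all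
owners / avoided sets / decoy lists (Theorem M1), THEN for `o ∉ A`, `c ∈ A` with `P_H(c↔b) ≤ P_H(a↔b)` (`a ∈ A`):
`P_G(c↔b ∩ o↔A) ≤ P_G(o↔b ∩ o↔A)`. [cite: KozmaNitzan2024, Question 9 (§5.5 p. 36), Conjecture 6 (§5.3 p. 34)] -/
theorem kn_question9_of_mixCSH (w : Sym2 (Fin n) → unitInterval) (o v : Fin n) (hov : o ≠ v)
    (hw : ∀ e : Sym2 (Fin n), e ∈ wireSet ({o}ᶜ : Set (Fin n)) → w e < 1)
    (hMix : ∀ (Sig : Set (Fin n)), o ∉ Sig → ∀ (x : Fin n) (Y : Finset (Fin n)) (D : List (Fin n)),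
      x ∉ Y → o ≠ x → v ≠ x → o ∉ Y → v ∉ Y → D.Nodup → (∀ d ∈ D, d ≠ x ∧ d ∉ Y ∧ d ≠ o ∧ d ≠ v) →
      MixCSHHolds (restrW ({o}ᶜ : Set (Fin n)) w) Sig x (↑Y : Set (Fin n)) D o v)
    (A : Finset (Fin n)) (hoA : o ∉ A) (hvA : v ∉ A) (b c : Fin n) (hcA : c ∈ A)
    (hmin : ∀ a ∈ A, (prodBernoulli (restrW ({o}ᶜ : Set (Fin n)) w)).real (openConn c b) ≤
      (prodBernoulli (restrW ({o}ᶜ : Set (Fin n)) w)).real (openConn a b)) :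
    (prodBernoulli w).real (openConn c b ∩ ⋃ a ∈ A, openConn o a) ≤
      (prodBernoulli w).real (openConn o b ∩ ⋃ a ∈ A, openConn o a) := by
  classical
  have hco : c ≠ o := fun h => hoA (h ▸ hcA)
  by_cases hbo : b = o
  · subst hbo
    refine measureReal_mono ?_ (measure_ne_top _ _)
    rintro ω ⟨_, h⟩
    exact ⟨SimpleGraph.Reachable.refl _, h⟩
  set wH := restrW ({o}ᶜ : Set (Fin n)) w with hwH
  have hwH1 : ∀ e, wH e < 1 := by
    intro e
    by_cases he : e ∈ wireSet ({o}ᶜ : Set (Fin n))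
    · rw [hwH, restrW_apply_of_mem w he]; exact hw e he
    · rw [hwH, restrW_apply_of_not_mem w he]; exact zero_lt_one
  refine KnQ9Pair.question9_of_setSource w o b c A hbo hco hoA fun Sig hoS => ?_
  -- Theorem M2 at `D = []` for the indicator functional
  set F : Set (Fin n) → ℝ := fun S => if b ∈ S then (1 : ℝ) else 0 with hF
  have hFmono : ∀ S T : Set (Fin n), S ⊆ T → F S ≤ F T := by
    intro S T hST
    by_cases hS : b ∈ S
    · simp [hF, hS, hST hS]
    · by_cases hT : b ∈ T
      · simp [hF, hS, hT]
      · simp [hF, hS, hT]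
  have hmean : ∀ x : Fin n, ∫ ω, F (openCluster ω x) ∂(prodBernoulli wH) = (prodBernoulli wH).real (openConn x b) := by
    intro x
    rw [← setIntegral_univ, Q7Psi.setIntegral_ite_mem_openCluster, inter_univ]
  have hcmin' : ∀ a ∈ A, ∫ ω, F (openCluster ω c) ∂(prodBernoulli wH) ≤ ∫ ω, F (openCluster ω a) ∂(prodBernoulli wH) := by
    intro a ha; rw [hmean, hmean]; exact hmin a ha
  have hM2 := mixPreMargin_nonneg_of_mixCSH wH hwH1 Sig o v hov (hMix Sig hoS) A c [] F hFmono hcA hcmin' hoA hvA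
    List.nodup_nil (fun d hd => by simp at hd)
  rw [mixPreMargin_nil] at hM2
  -- the `v`-entry is Question 7 in `H` (`c` is the `H`-minimiser)
  have hv : 0 ≤ mixPreF wH Sig o A c F v := by
    rw [mixPreF_of_ne wH Sig hov.symm, integral_sub (Integrable.of_finite).integrableOn (Integrable.of_finite).integrableOn,
      Q7Psi.setIntegral_ite_mem_openCluster, Q7Psi.setIntegral_ite_mem_openCluster]
    linarith [Q7Psi.kn_question7 wH A v b c hcA hmin]
  have hp : 0 ≤ mixObsConst wH Sig v (↑A : Set (Fin n)) := by
    unfold mixObsConst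
    exact div_nonneg measureReal_nonneg measureReal_nonneg
  have ho : 0 ≤ mixPreF wH Sig o A c F o := by nlinarith [hM2, mul_nonneg hp hv]
  rw [mixPreF_hub_indicator] at ho
  linarith

end MixCSH

end Summit.CriticalPhenomena.PercolationContinuityZ3.Theorems
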